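import Literature.MathematicalPhysics.QuantumLattice.SpinPartialTrace
import Literature.MathematicalPhysics.QuantumLattice.CorrelationLightCone
import HarnessLib

/-!
# The partial trace onto the complement of a region: `spinPartialTrace` along a region inclusion,
# the tensor split of configurations, and the BHV twirl as `Γ ∘ tr`

Family `hubbard` (topic `MathematicalPhysics/QuantumLattice`; a bridge file requested by the sr-mbsolver
literature lead so that the entropy / weak-monotonicity facts and the light-cone twirl do not open a second
partial-trace vocabulary). The tree has, in `CorrelationLightCone`, the *normalised* partial trace over a region
`S ⊆ Λ`, `partialTraceNormalized S M : Matrix (↥Sᶜ → Fin q) (↥Sᶜ → Fin q) ℂ`,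
`(s,t) ↦ (dim 𝓗_S)⁻¹ Σ_c M(c ⊔ s, c ⊔ t)` (Bravyi–Hastings–Verstraete's `Tr_S(·)/Tr_S(𝟙_S)`), and, in
`SpinPartialTrace`, the partial trace `spinPartialTrace φ` along any site injection `φ : X ↪ Y`
(Nielsen–Chuang's `tr_B`, the Hilbert–Schmidt adjoint of `spinEmbed φ`). This file identifies them:

* `spinEmbed_subtype`: along the inclusion of a region `T ⊆ Λ`, `Γ = spinEmbed (subtype (· ∈ T))` IS the
  tree's `localOp T` (`A ↦ A ⊗ 𝟙_{Λ∖T}`);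
* `glueComplEquiv S q : (S → Fin q) × (↥Sᶜ → Fin q) ≃ TensorIndex Λ q`, the tensor split
  `𝓗_Λ = 𝓗_S ⊗ 𝓗_{Λ∖S}` at the level of configurations (Bratteli–Robinson II §6.2.1), built on the tree's
  `glueCompl`;
* `spinPartialTrace_subtype_compl_apply`: the reduced density matrix on `Λ∖S` has entries
  `(tr_S M)_{ts} = Σ_c M_{(c,t),(c,s)}` (Nielsen–Chuang eq. (2.178)), hence
  **`partialTraceNormalized S M = (dim 𝓗_S)⁻¹ • spinPartialTrace (subtype (· ∈ Sᶜ)) M`**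
  (`partialTraceNormalized_eq_smul_spinPartialTrace`) — the un-normalised version is the reduced density
  matrix (trace-preserving, PSD-preserving: `SpinPartialTrace`), the normalised one has trace `(dim 𝓗_S)⁻¹ tr M`;
* the twirl as a conditional expectation: **`twirl S M = (dim 𝓗_S)⁻¹ • Γ_{Λ∖S} (tr_S M)`**
  (`twirl_eq_smul_spinEmbed_spinPartialTrace`), and it is trace preserving (`trace_twirl`), via
  `spinPartialTrace_subtype_compl_one : tr_S 𝟙 = (dim 𝓗_S) • 𝟙` and `trace_spinEmbed_subtype_compl :
  tr (A ⊗ 𝟙_S) = dim 𝓗_S · tr A`;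
* every `spinPartialTrace φ` is, up to the relabelling `rangeEquiv φ : X ≃ φ(X)`, the partial trace onto the
  region `φ(X)` (`spinPartialTrace_eq_reindexOp_spinPartialTrace_subtype`), so results stated for region
  inclusions transfer to arbitrary site injections (windows `Fin m ↪ ring`, …).

Everything is PROVED; the only definition (`glueComplEquiv`) has a body; no named facts.

## References
* M. A. Nielsen, I. L. Chuang, *Quantum Computation and Quantum Information* (10th anniversary ed., CUP 2010),
  §2.4.3, eqs. (2.177)–(2.178) (reduced density operator, `tr_B`), Box 2.6, pp. 105–107.
  [cite: NielsenChuang2010, §2.4.3]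
* O. Bratteli, D. W. Robinson, *Operator Algebras and Quantum Statistical Mechanics II*, 2nd ed. (Springer 1997),
  §6.2.1 (`𝓗_Λ = ⊗_{x∈Λ} 𝓗_x`, `𝔄_{Λ₁} ≅ 𝔄_{Λ₁} ⊗ 𝟙_{Λ₂∖Λ₁}`, partial states by restriction).
  [cite: BratteliRobinsonII1997, §6.2.1]
* S. Bravyi, M. B. Hastings, F. Verstraete, *Lieb–Robinson bounds and the generation of correlations and
  topological quantum order*, Phys. Rev. Lett. 97, 050401 (2006) = arXiv:quant-ph/0603121, text after Eq. (2)
  (`O^l_A(t) = ∫dμ(U) U O_A(t) U† = Tr_S(O_A(t)) ⊗ 𝟙_S / Tr_S 𝟙_S`).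
  [cite: BravyiHastingsVerstraete2006, arXiv Eq. (2) ff.]

## Mathlib / tree
Used: `Equiv.sum_comp`, `Fintype.sum_prod_type`, `Matrix.single_apply`; tree: `spinEmbed_apply`,
`localOp_apply`, `glueCompl`, `partialTraceNormalized`, `twirl_eq_localOp` (CorrelationLightCone),
`spinPartialTrace_apply`, `spinPartialTrace_trans`, `spinPartialTrace_equiv`, `trace_mul_spinPartialTrace`
(SpinPartialTrace), `rangeSites` / `rangeEquiv` (HubbardCouplingTransport).
-/

noncomputable section

namespace Literature.MathematicalPhysics.QuantumLattice

open Matrix Finset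
open scoped ComplexOrder BigOperators

section Region

variable {Λ : Type*} [Fintype Λ] [DecidableEq Λ] {q : ℕ}

/-! ### `spinEmbed` along a region inclusion is `localOp` -/

omit [Fintype Λ] [DecidableEq Λ] in
/-- Membership in the range of the inclusion `↥T ↪ Λ` of a region. [folklore] -/
private theorem mem_range_subtype_iff (T : Finset Λ) (y : Λ) :
    y ∈ Set.range (Function.Embedding.subtype (· ∈ T)) ↔ y ∈ T := by
  constructor
  · rintro ⟨x, rfl⟩
    exact x.2
  · intro hy
    exact ⟨⟨y, hy⟩, rfl⟩

/-- **Along the inclusion of a region `T ⊆ Λ`, `Γ = spinEmbed` is the tree's `localOp T`**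
(`A ↦ A ⊗ 𝟙_{Λ∖T}`, Bratteli–Robinson's isotony `𝔄_T ↪ 𝔄_Λ`). [cite: BratteliRobinsonII1997, §6.2.1] -/
theorem spinEmbed_subtype (T : Finset Λ) (A : Matrix (↥T → Fin q) (↥T → Fin q) ℂ) :
    spinEmbed (Function.Embedding.subtype (· ∈ T)) A = localOp T A := by
  ext σ τ
  rw [spinEmbed_apply, localOp_apply]
  have hc : (∀ y, y ∉ Set.range (Function.Embedding.subtype (· ∈ T)) → σ y = τ y) ↔
      (∀ y, y ∉ T → σ y = τ y) :=
    forall_congr' fun y => by rw [mem_range_subtype_iff]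
  rw [if_congr hc rfl rfl]
  rfl

/-- An operator is supported on `T` iff it is in the range of `spinEmbed` along the inclusion of `T`.
[cite: BratteliRobinsonII1997, §6.2.1] -/
theorem isSupportedOn_iff_exists_spinEmbed_subtype (T : Finset Λ) (B : Op Λ q) :
    IsSupportedOn B T ↔ ∃ A : Op ↥T q, spinEmbed (Function.Embedding.subtype (· ∈ T)) A = B := by
  simp only [IsSupportedOn, Set.mem_range, spinEmbed_subtype]

/-! ### The tensor split of configurations along `Λ = S ⊔ (Λ∖S)` -/

variable (S : Finset Λ)

/-- `glueCompl` on a site of `S`. [cite: BratteliRobinsonII1997, §6.2.1] -/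
@[simp] theorem glueCompl_apply_of_mem (c : S → Fin q) (s : ↥(Sᶜ) → Fin q) {x : Λ} (hx : x ∈ S) :
    glueCompl S c s x = c ⟨x, hx⟩ := by
  rw [glueCompl, dif_pos hx]

/-- `glueCompl` on a site outside `S`. [cite: BratteliRobinsonII1997, §6.2.1] -/
@[simp] theorem glueCompl_apply_of_not_mem (c : S → Fin q) (s : ↥(Sᶜ) → Fin q) {x : Λ} (hx : x ∉ S) :
    glueCompl S c s x = s ⟨x, mem_compl.2 hx⟩ := by
  rw [glueCompl, dif_neg hx]

/-- `glueCompl c s` restricted to `S` is `c`. [cite: BratteliRobinsonII1997, §6.2.1] -/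
@[simp] theorem glueCompl_apply_coe (c : S → Fin q) (s : ↥(Sᶜ) → Fin q) (x : S) :
    glueCompl S c s x = c x := by
  rw [glueCompl_apply_of_mem S c s x.2]

/-- `glueCompl c s` restricted to `Λ∖S` is `s`. [cite: BratteliRobinsonII1997, §6.2.1] -/
@[simp] theorem glueCompl_apply_coe_compl (c : S → Fin q) (s : ↥(Sᶜ) → Fin q) (x : ↥(Sᶜ)) :
    glueCompl S c s x = s x := by
  rw [glueCompl_apply_of_not_mem S c s (mem_compl.1 x.2)]

/-- **The tensor split `𝓗_Λ = 𝓗_S ⊗ 𝓗_{Λ∖S}` at the level of configurations**: gluing a configuration of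
`S` with one of `Λ∖S` is a bijection onto the configurations of `Λ` (inverse: restriction to `S` and to
`Λ∖S`). [cite: BratteliRobinsonII1997, §6.2.1] -/
def glueComplEquiv (S : Finset Λ) (q : ℕ) : (S → Fin q) × (↥(Sᶜ) → Fin q) ≃ TensorIndex Λ q where
  toFun p := glueCompl S p.1 p.2
  invFun σ := (fun x => σ x, fun x => σ x)
  left_inv p := by
    obtain ⟨c, s⟩ := p
    simp only [glueCompl_apply_coe, glueCompl_apply_coe_compl]
  right_inv σ := by
    funext x
    by_cases hx : x ∈ S
    · simp only [glueCompl_apply_of_mem S _ _ hx]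
    · simp only [glueCompl_apply_of_not_mem S _ _ hx]

/-- `glueComplEquiv S q (c, s) = glueCompl S c s`. [cite: BratteliRobinsonII1997, §6.2.1] -/
@[simp] theorem glueComplEquiv_apply (c : S → Fin q) (s : ↥(Sᶜ) → Fin q) :
    glueComplEquiv S q (c, s) = glueCompl S c s := rfl

/-- The inverse split is restriction: `(glueComplEquiv S q)⁻¹ σ = (σ|_S, σ|_{Λ∖S})`.
[cite: BratteliRobinsonII1997, §6.2.1] -/
@[simp] theorem glueComplEquiv_symm_apply (σ : TensorIndex Λ q) :
    (glueComplEquiv S q).symm σ = (fun x : S => σ x, fun x : ↥(Sᶜ) => σ x) := rfl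

/-- Two glued configurations agree off the range of the inclusion of `Λ∖S` (i.e. on `S`) iff their
`S`-parts agree. [folklore] -/
private theorem agree_off_range_subtype_compl_iff (c c' : S → Fin q) (s t : ↥(Sᶜ) → Fin q) :
    (∀ y, y ∉ Set.range (Function.Embedding.subtype (· ∈ Sᶜ)) → glueCompl S c s y = glueCompl S c' t y) ↔
      c = c' := by
  constructor
  · intro h
    funext x
    have hx : (x : Λ) ∉ Set.range (Function.Embedding.subtype (· ∈ Sᶜ)) := by
      rw [mem_range_subtype_iff, mem_compl, not_not]
      exact x.2
    simpa only [glueCompl_apply_coe] using h x hx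
  · rintro rfl y hy
    rw [mem_range_subtype_iff, mem_compl, not_not] at hy
    rw [glueCompl_apply_of_mem S _ _ hy, glueCompl_apply_of_mem S _ _ hy]

/-- Double sums over configurations of `Λ`, split along `Λ = S ⊔ (Λ∖S)`. [folklore] -/
private theorem sum_sum_glueCompl (G : TensorIndex Λ q → TensorIndex Λ q → ℂ) :
    ∑ σ, ∑ τ, G σ τ =
      ∑ c : S → Fin q, ∑ s : ↥(Sᶜ) → Fin q, ∑ c' : S → Fin q, ∑ t : ↥(Sᶜ) → Fin q,
        G (glueCompl S c s) (glueCompl S c' t) := by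
  rw [← (glueComplEquiv S q).sum_comp, Fintype.sum_prod_type]
  refine Finset.sum_congr rfl fun c _ => Finset.sum_congr rfl fun s _ => ?_
  rw [← (glueComplEquiv S q).sum_comp, Fintype.sum_prod_type]
  rfl

/-! ### The partial trace over a region `S` = `spinPartialTrace` along the inclusion of `Λ∖S` -/

/-- **Entries of the reduced density matrix on `Λ∖S`** (Nielsen–Chuang eq. (2.178) for the split
`𝓗_Λ = 𝓗_S ⊗ 𝓗_{Λ∖S}`): `(tr_S M)_{ts} = Σ_{c : S → Fin q} M_{(c ⊔ t),(c ⊔ s)}`.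
[cite: NielsenChuang2010, §2.4.3 eq. (2.178)] -/
theorem spinPartialTrace_subtype_compl_apply (M : Op Λ q) (t s : ↥(Sᶜ) → Fin q) :
    spinPartialTrace (Function.Embedding.subtype (· ∈ Sᶜ)) M t s =
      ∑ c : S → Fin q, M (glueCompl S c t) (glueCompl S c s) := by
  rw [spinPartialTrace_apply, Matrix.trace]
  simp only [Matrix.diag_apply, Matrix.mul_apply, spinEmbed_apply, Function.Embedding.subtype_apply,
    Matrix.single_apply]
  rw [sum_sum_glueCompl S]
  simp only [agree_off_range_subtype_compl_iff, glueCompl_apply_coe_compl, ite_and, ite_mul, one_mul,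
    zero_mul, Finset.sum_ite_irrel, Finset.sum_const_zero, Finset.sum_ite_eq, Finset.mem_univ, if_true]

/-- Entries of the tree's normalised partial trace (definitional unfolding):
`partialTraceNormalized S M s t = (dim 𝓗_S)⁻¹ Σ_c M_{(c ⊔ s),(c ⊔ t)}`.
[cite: BravyiHastingsVerstraete2006, arXiv Eq. (2) ff.] -/
theorem partialTraceNormalized_apply (M : Op Λ q) (s t : ↥(Sᶜ) → Fin q) :
    partialTraceNormalized S M s t =
      ((Fintype.card (S → Fin q) : ℂ))⁻¹ * ∑ c : S → Fin q, M (glueCompl S c s) (glueCompl S c t) := rfl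

/-- **The normalised partial trace of Bravyi–Hastings–Verstraete is `(dim 𝓗_S)⁻¹` times the reduced
density matrix on `Λ∖S`**: `partialTraceNormalized S M = (dim 𝓗_S)⁻¹ • spinPartialTrace (↥Sᶜ ↪ Λ) M`.
[cite: BravyiHastingsVerstraete2006, arXiv Eq. (2) ff.] -/
theorem partialTraceNormalized_eq_smul_spinPartialTrace (M : Op Λ q) :
    partialTraceNormalized S M =
      ((Fintype.card (S → Fin q) : ℂ))⁻¹ • spinPartialTrace (Function.Embedding.subtype (· ∈ Sᶜ)) M := by
  ext s t
  rw [Matrix.smul_apply, smul_eq_mul, spinPartialTrace_subtype_compl_apply, partialTraceNormalized_apply]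

/-- Conversely the reduced density matrix on `Λ∖S` is `dim 𝓗_S` times the normalised partial trace.
[cite: NielsenChuang2010, §2.4.3 eq. (2.178)] -/
theorem spinPartialTrace_subtype_compl_eq_smul_partialTraceNormalized (M : Op Λ q) :
    spinPartialTrace (Function.Embedding.subtype (· ∈ Sᶜ)) M =
      (Fintype.card (S → Fin q) : ℂ) • partialTraceNormalized S M := by
  rw [partialTraceNormalized_eq_smul_spinPartialTrace, smul_smul]
  rcases isEmpty_or_nonempty (S → Fin q) with hE | hne
  · -- `q = 0`, `S ≠ ∅`: both sides vanish entrywise (empty sums)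
    ext t s
    simp [spinPartialTrace_subtype_compl_apply]
  · rw [mul_inv_cancel₀ (Nat.cast_ne_zero.2 Fintype.card_ne_zero), one_smul]

/-- **Duality for the normalised partial trace**: `tr (A · partialTraceNormalized S M) =
(dim 𝓗_S)⁻¹ tr ((A ⊗ 𝟙_S) M)` for every `A ∈ 𝔄_{Λ∖S}`. [cite: NielsenChuang2010, §2.4.3 Box 2.6 eq. (2.180)] -/
theorem trace_mul_partialTraceNormalized (A : Op ↥(Sᶜ) q) (M : Op Λ q) :
    (A * partialTraceNormalized S M).trace = ((Fintype.card (S → Fin q) : ℂ))⁻¹ * (localOp Sᶜ A * M).trace := by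
  rw [partialTraceNormalized_eq_smul_spinPartialTrace, Matrix.mul_smul, Matrix.trace_smul, smul_eq_mul,
    trace_mul_spinPartialTrace, spinEmbed_subtype]

/-- The normalised partial trace of a positive semidefinite operator is positive semidefinite.
[cite: NielsenChuang2010, §2.4.3] -/
theorem posSemidef_partialTraceNormalized {M : Op Λ q} (hM : M.PosSemidef) :
    (partialTraceNormalized S M).PosSemidef := by
  rw [partialTraceNormalized_eq_smul_spinPartialTrace]
  have h0 : (0 : ℂ) ≤ ((Fintype.card (S → Fin q) : ℂ))⁻¹ := by
    rw [← Complex.ofReal_natCast, ← Complex.ofReal_inv]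
    exact Complex.zero_le_real.2 (inv_nonneg.2 (Nat.cast_nonneg _))
  exact (posSemidef_spinPartialTrace _ hM).smul h0

/-- Trace of the normalised partial trace: `tr (partialTraceNormalized S M) = (dim 𝓗_S)⁻¹ tr M` (so for a
density matrix `M` it is the reduced density matrix divided by `dim 𝓗_S`, not a density matrix).
[cite: NielsenChuang2010, §2.4.3] -/
theorem trace_partialTraceNormalized (M : Op Λ q) :
    (partialTraceNormalized S M).trace = ((Fintype.card (S → Fin q) : ℂ))⁻¹ * M.trace := by
  rw [partialTraceNormalized_eq_smul_spinPartialTrace, Matrix.trace_smul, smul_eq_mul, trace_spinPartialTrace]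

/-! ### The twirl as `(dim 𝓗_S)⁻¹ · Γ_{Λ∖S} ∘ tr_S`; trace preservation -/

/-- **The BHV twirl is the conditional expectation `(dim 𝓗_S)⁻¹ · Γ_{Λ∖S} (tr_S M)`**:
`twirl S M = (dim 𝓗_S)⁻¹ • spinEmbed (↥Sᶜ ↪ Λ) (spinPartialTrace (↥Sᶜ ↪ Λ) M)`.
[cite: BravyiHastingsVerstraete2006, arXiv Eq. (2) ff.] -/
theorem twirl_eq_smul_spinEmbed_spinPartialTrace (M : Op Λ q) :
    twirl S M = ((Fintype.card (S → Fin q) : ℂ))⁻¹ •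
      spinEmbed (Function.Embedding.subtype (· ∈ Sᶜ))
        (spinPartialTrace (Function.Embedding.subtype (· ∈ Sᶜ)) M) := by
  rw [twirl_eq_localOp, partialTraceNormalized_eq_smul_spinPartialTrace, ← spinEmbed_subtype, map_smul]

/-- `tr_S 𝟙_Λ = (dim 𝓗_S) • 𝟙_{Λ∖S}`. [cite: NielsenChuang2010, §2.4.3 eq. (2.178)] -/
theorem spinPartialTrace_subtype_compl_one :
    spinPartialTrace (Function.Embedding.subtype (· ∈ Sᶜ)) (1 : Op Λ q) =
      (Fintype.card (S → Fin q) : ℂ) • (1 : Op ↥(Sᶜ) q) := by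
  ext t s
  rw [spinPartialTrace_subtype_compl_apply, Matrix.smul_apply, Matrix.one_apply, smul_eq_mul]
  by_cases h : t = s
  · subst h
    simp only [Matrix.one_apply_eq, Finset.sum_const, Finset.card_univ, nsmul_eq_mul, mul_one, if_true]
  · rw [if_neg h, mul_zero]
    refine Finset.sum_eq_zero fun c _ => Matrix.one_apply_ne fun hc => h ?_
    funext x
    simpa only [glueCompl_apply_coe_compl] using congrFun hc x

/-- **`tr (A ⊗ 𝟙_S) = dim 𝓗_S · tr A`** for `A ∈ 𝔄_{Λ∖S}` (trace of an ampliation).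
[cite: NielsenChuang2010, §2.4.3 eq. (2.178)] -/
theorem trace_spinEmbed_subtype_compl (A : Op ↥(Sᶜ) q) :
    (spinEmbed (Function.Embedding.subtype (· ∈ Sᶜ)) A).trace = (Fintype.card (S → Fin q) : ℂ) * A.trace := by
  rw [← Matrix.mul_one (spinEmbed _ A), ← trace_mul_spinPartialTrace, spinPartialTrace_subtype_compl_one,
    Matrix.mul_smul, Matrix.mul_one, Matrix.trace_smul, smul_eq_mul]

/-- `tr (localOp Sᶜ A) = dim 𝓗_S · tr A`. [cite: NielsenChuang2010, §2.4.3 eq. (2.178)] -/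
theorem trace_localOp_compl (A : Op ↥(Sᶜ) q) :
    (localOp Sᶜ A).trace = (Fintype.card (S → Fin q) : ℂ) * A.trace := by
  rw [← spinEmbed_subtype, trace_spinEmbed_subtype_compl]

/-- **The twirl is trace preserving**: `tr (twirl S M) = tr M`.
[cite: BravyiHastingsVerstraete2006, arXiv Eq. (2) ff.] -/
theorem trace_twirl (M : Op Λ q) : (twirl S M).trace = M.trace := by
  rcases isEmpty_or_nonempty (S → Fin q) with hE | hne
  · -- `q = 0`, `S ≠ ∅`: there are no configurations of `Λ` at all
    haveI : IsEmpty (TensorIndex Λ q) := Function.isEmpty fun (σ : TensorIndex Λ q) (x : ↥S) => σ x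
    simp [Matrix.trace]
  have hN : (Fintype.card (S → Fin q) : ℂ) ≠ 0 := Nat.cast_ne_zero.2 Fintype.card_ne_zero
  rw [twirl_eq_smul_spinEmbed_spinPartialTrace, Matrix.trace_smul, smul_eq_mul, trace_spinEmbed_subtype_compl,
    trace_spinPartialTrace, ← mul_assoc, inv_mul_cancel₀ hN, one_mul]

/-- **The twirl is the identity on `𝔄_{Λ∖S}`** (conditional-expectation property):
`twirl S (A ⊗ 𝟙_S) = A ⊗ 𝟙_S`. [cite: BravyiHastingsVerstraete2006, arXiv Eq. (2) ff.] -/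
theorem twirl_spinEmbed_subtype_compl (A : Op ↥(Sᶜ) q) :
    twirl S (spinEmbed (Function.Embedding.subtype (· ∈ Sᶜ)) A) =
      spinEmbed (Function.Embedding.subtype (· ∈ Sᶜ)) A := by
  rcases isEmpty_or_nonempty (S → Fin q) with hE | hne
  · haveI : IsEmpty (TensorIndex Λ q) := Function.isEmpty fun (σ : TensorIndex Λ q) (x : ↥S) => σ x
    exact Subsingleton.elim _ _
  have hN : (Fintype.card (S → Fin q) : ℂ) ≠ 0 := Nat.cast_ne_zero.2 Fintype.card_ne_zero
  have hred : spinPartialTrace (Function.Embedding.subtype (· ∈ Sᶜ))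
      (spinEmbed (Function.Embedding.subtype (· ∈ Sᶜ)) A) = (Fintype.card (S → Fin q) : ℂ) • A := by
    refine (eq_spinPartialTrace_of_forall_trace_mul _ _ fun B => ?_).symm
    rw [Matrix.mul_smul, Matrix.trace_smul, smul_eq_mul, ← map_mul, trace_spinEmbed_subtype_compl]
  rw [twirl_eq_smul_spinEmbed_spinPartialTrace, hred, map_smul, smul_smul, inv_mul_cancel₀ hN, one_smul]

end Region

/-! ### Every `spinPartialTrace φ` is the partial trace onto the region `φ(X)`, relabelled -/

section Range

variable {X Y : Type*} [Fintype X] [DecidableEq X] [Fintype Y] [DecidableEq Y] {q : ℕ}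

omit [DecidableEq X] [Fintype Y] [DecidableEq Y] in
/-- `φ` factors as the bijection onto its range followed by the inclusion of the range.
[cite: BratteliRobinsonII1997, §6.2.1] -/
theorem rangeEquiv_toEmbedding_trans_subtype (φ : X ↪ Y) :
    (rangeEquiv φ).toEmbedding.trans (Function.Embedding.subtype (· ∈ rangeSites φ)) = φ := by
  ext x
  rfl

/-- **`spinPartialTrace φ` is the partial trace onto the region `φ(X) ⊆ Y`, relabelled along
`rangeEquiv φ : X ≃ φ(X)`**: `tr_{Y∖X} σ = reindexOp (rangeEquiv φ)⁻¹ (tr_{Y∖φ(X)} σ)`.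
[cite: NielsenChuang2010, §2.4.3 eqs. (2.177)–(2.178)] -/
theorem spinPartialTrace_eq_reindexOp_spinPartialTrace_subtype (φ : X ↪ Y) (σ : Op Y q) :
    spinPartialTrace φ σ =
      reindexOp (rangeEquiv φ).symm
        (spinPartialTrace (Function.Embedding.subtype (· ∈ rangeSites φ)) σ) := by
  conv_lhs => rw [← rangeEquiv_toEmbedding_trans_subtype φ]
  rw [spinPartialTrace_trans, spinPartialTrace_equiv]

/-- `spinEmbed φ` is `localOp` on the region `φ(X)` after relabelling (the tree's definitional
`spinEmbed_eq_localOp`, restated through `spinEmbed_subtype`). [cite: BratteliRobinsonII1997, §6.2.1] -/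
theorem spinEmbed_eq_spinEmbed_subtype_reindexOp (φ : X ↪ Y) (A : Op X q) :
    spinEmbed φ A =
      spinEmbed (Function.Embedding.subtype (· ∈ rangeSites φ)) (reindexOp (rangeEquiv φ) A) := by
  rw [spinEmbed_subtype, spinEmbed_eq_localOp]

end Range

end Literature.MathematicalPhysics.QuantumLattice
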